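import Summits.ResolutionOfSingularities.ResolutionOfSingularities.Theorems.WeightedInvariantLexMaxOrderDrop
import HarnessLib

/-!
# AQS Thm 1.3 (3) in kernel: the order drop on `B₊` for the lex-maximal centre — `ν ≥ 2` and `adicOrder` forms
# (door `HypersurfaceCentreConstruction`, (o25-β), part 2c)

Topic: `Summits/ResolutionOfSingularities/ResolutionOfSingularities/Theorems`. Helper for the door item
`HypersurfaceCentreConstruction` (statement `stmt-ResolutionOfSingularities-19897`, route `WeightedInvariant`), line
`local-engine` of `res-L1-w43-plan-1`, ORDER (o25-β): consumer-facing corollaries of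
`LexMaxOrderDrop.iotaOrd_transform_lt_of_isLexMax` (`…LexMaxOrderDrop`):

* `iotaOrd_transform_lt_of_isLexMax'` — for `ν ≥ 2` the drop `iotaOrd B_𝔫 g < ν` holds at EVERY prime `𝔫 ∋ t⁻¹` over `𝔪`
  off the vertex and every `t⁻¹`-saturated transform `g`, with no singularity hypothesis on `g` (outside `𝔪_𝔫²` the order
  is `≤ 1 < ν`);
* `adicOrder_transform_lt_of_isLexMax` — the same in the `ℕ∞`-valued currency `adicOrder` of
  `Literature/…/RegularLocalOrderValuation.lean`, with the hypotheses `ringKrullDim S = 2` and `adicOrder f = ν` — the binder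
  shape of clause (3)/(5) of `AbramovichQuekSchober2025_heightTwoCentre` and of res-type-092's (o25) design
  (`AQSHeightTwo.adicOrder_transform_lt`, O25-DESIGN.md §2 (β2)), keyed on the lex-maximal datum `(x; w; ℓ)` itself.

[OURS · L1 W4.3] Replaces the role of NO printed item of the manuscript under review [claim: Hironaka2017,
status: under-review]; re-proves Abramovich–Quek–Schober 2025 Thm 1.3 (3) (arXiv:2507.01232v3 §5) in the tree's vocabulary.
AI work, weaker than expert review.

## References

* D. Abramovich, M. H. Quek, B. Schober, *Torus actions, weighted blow-ups, and desingularization of plane curves*,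
  arXiv:2507.01232 (v3, 2026), Thm 1.3 (3), §5. [AbramovichQuekSchober2025]
-/

noncomputable section

open IsLocalRing Literature.AlgebraicGeometry.Resolution
open Summit.ResolutionOfSingularities.ResolutionOfSingularities.Cruxes.HypersurfaceCentreConstruction.LocalEngine
  (iotaOrd iotaOrd_eq_ordOfENat_adicOrder ordOfENat_natCast ordOfENat_lt_ordOfENat)

set_option linter.dupNamespace false -- mandated namespace of this single-conjunct summit

namespace Summit.ResolutionOfSingularities.ResolutionOfSingularities.Theorems

namespace LexMaxOrderDrop

variable {S : Type} [CommRing S] [IsRegularLocalRing S] {f : S} {x : Fin 2 → S} {w : Fin 2 → ℕ} {ℓ ν : ℕ}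

/-- **AQS Thm 1.3 (3) at EVERY point of `B₊` over the closed point** (no singularity hypothesis on the transform): with
`ν ≥ 2` (the position `f ∈ 𝔪²` of the game), `iotaOrd B_𝔫 g < ν` for every `t⁻¹`-saturated transform `g` at every prime
`𝔫 ∋ t⁻¹` over `𝔪` off the vertex (a transform outside `𝔪_𝔫²` has order `≤ 1 < ν`).
[cite: AbramovichQuekSchober2025, Thm 1.3 (3), §5] -/
theorem iotaOrd_transform_lt_of_isLexMax' (hd : (maximalIdeal S).spanFinrank = 2)
    (hlex : IsLexMaxWeightedCentreGerm S (Ideal.span {f}) x w ℓ) (hℓ : ℓ = w 0 * ν) (hν : 2 ≤ ν)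
    (hfν : f ∈ maximalIdeal S ^ ν) (hfν' : f ∉ maximalIdeal S ^ (ν + 1)) :
    ∀ (𝔫 : Ideal (extReesAlgebra (weightedMonomialIdeal x w))) [𝔫.IsPrime],
      extReesAlgebra.tInv (weightedMonomialIdeal x w) ∈ 𝔫 →
      (maximalIdeal S).map (algebraMap S (extReesAlgebra (weightedMonomialIdeal x w))) ≤ 𝔫 →
      ¬ (extReesAlgebra.vertexIdeal (weightedMonomialIdeal x w) ≤ 𝔫) →
      ∀ (a : ℕ) (g : extReesAlgebra (weightedMonomialIdeal x w)),
        algebraMap S (extReesAlgebra (weightedMonomialIdeal x w)) f =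
          extReesAlgebra.tInv (weightedMonomialIdeal x w) ^ a * g →
        ¬ (extReesAlgebra.tInv (weightedMonomialIdeal x w) ∣ g) →
        iotaOrd (Localization.AtPrime 𝔫)
          (algebraMap (extReesAlgebra (weightedMonomialIdeal x w)) (Localization.AtPrime 𝔫) g) < ν := by
  intro 𝔫 _ hT hM hV a g hfg hndvd
  by_cases hg2 : algebraMap (extReesAlgebra (weightedMonomialIdeal x w)) (Localization.AtPrime 𝔫) g ∈
      (maximalIdeal (Localization.AtPrime 𝔫)) ^ 2
  · exact iotaOrd_transform_lt_of_isLexMax hd hlex hℓ hfν hfν' (by omega) 𝔫 hT hM hV a g hfg hndvd hg2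
  · exact lt_of_lt_of_le (LocalGameEFTFace.iotaOrd_lt_of_notMem_pow hg2) (by exact_mod_cast hν)

/-- **AQS Thm 1.3 (3), `adicOrder` currency.** `S` regular local of Krull dimension two, `ord f = ν ≥ 2`, `(x; w; ℓ)` the
lex-maximal weighted centre germ of `(f)` with `ℓ = w₀ν`: at every prime `𝔫 ∋ t⁻¹` of `B = S[t⁻¹, 𝒥ₙtⁿ]` over `𝔪` off the
vertex and for every factorisation `f = t⁻ᵃg`, `t⁻¹ ∤ g`, `adicOrder (g/1 ∈ B_𝔫) < ν`. (The binder shape of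
`AQSHeightTwo.adicOrder_transform_lt` of res-type-092's (o25) design, keyed on the lex-max datum instead of the certificate.)
[cite: AbramovichQuekSchober2025, Thm 1.3 (3), §5] -/
theorem adicOrder_transform_lt_of_isLexMax (hdim : ringKrullDim S = 2)
    (hlex : IsLexMaxWeightedCentreGerm S (Ideal.span {f}) x w ℓ) (hℓ : ℓ = w 0 * ν) (hν : 2 ≤ ν)
    (hord : adicOrder f = (ν : ℕ∞)) :
    ∀ (𝔫 : Ideal (extReesAlgebra (weightedMonomialIdeal x w))) [𝔫.IsPrime],
      extReesAlgebra.tInv (weightedMonomialIdeal x w) ∈ 𝔫 →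
      (maximalIdeal S).map (algebraMap S (extReesAlgebra (weightedMonomialIdeal x w))) ≤ 𝔫 →
      ¬ (extReesAlgebra.vertexIdeal (weightedMonomialIdeal x w) ≤ 𝔫) →
      ∀ (a : ℕ) (g : extReesAlgebra (weightedMonomialIdeal x w)),
        algebraMap S (extReesAlgebra (weightedMonomialIdeal x w)) f =
          extReesAlgebra.tInv (weightedMonomialIdeal x w) ^ a * g →
        ¬ (extReesAlgebra.tInv (weightedMonomialIdeal x w) ∣ g) →
        adicOrder (algebraMap (extReesAlgebra (weightedMonomialIdeal x w)) (Localization.AtPrime 𝔫) g) < (ν : ℕ∞) := by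
  intro 𝔫 _ hT hM hV a g hfg hndvd
  have hfν : f ∈ maximalIdeal S ^ ν := (le_adicOrder_iff f ν).mp hord.ge
  have hfν' : f ∉ maximalIdeal S ^ (ν + 1) := (adicOrder_le_iff f ν).mp hord.le
  have h := iotaOrd_transform_lt_of_isLexMax' (LocalGameEFTDimTwo.spanFinrank_eq_two hdim) hlex hℓ hν hfν hfν'
    𝔫 hT hM hV a g hfg hndvd
  rw [iotaOrd_eq_ordOfENat_adicOrder, ← ordOfENat_natCast, ordOfENat_lt_ordOfENat] at h
  exact h

/-- The same with the order read as `ℓ / w 0` (the spelling of clause (3) of `AbramovichQuekSchober2025_heightTwoCentre`):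
`ℓ / w 0 = ord f` and `2 ≤ ℓ / w 0`. [cite: AbramovichQuekSchober2025, Thm 1.3 (3), §5] -/
theorem adicOrder_transform_lt_of_isLexMax' (hdim : ringKrullDim S = 2)
    (hlex : IsLexMaxWeightedCentreGerm S (Ideal.span {f}) x w ℓ) (hν : 2 ≤ ℓ / w 0)
    (hord : adicOrder f = ((ℓ / w 0 : ℕ) : ℕ∞)) :
    ∀ (𝔫 : Ideal (extReesAlgebra (weightedMonomialIdeal x w))) [𝔫.IsPrime],
      extReesAlgebra.tInv (weightedMonomialIdeal x w) ∈ 𝔫 →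
      (maximalIdeal S).map (algebraMap S (extReesAlgebra (weightedMonomialIdeal x w))) ≤ 𝔫 →
      ¬ (extReesAlgebra.vertexIdeal (weightedMonomialIdeal x w) ≤ 𝔫) →
      ∀ (a : ℕ) (g : extReesAlgebra (weightedMonomialIdeal x w)),
        algebraMap S (extReesAlgebra (weightedMonomialIdeal x w)) f =
          extReesAlgebra.tInv (weightedMonomialIdeal x w) ^ a * g →
        ¬ (extReesAlgebra.tInv (weightedMonomialIdeal x w) ∣ g) →
        adicOrder (algebraMap (extReesAlgebra (weightedMonomialIdeal x w)) (Localization.AtPrime 𝔫) g) <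
          ((ℓ / w 0 : ℕ) : ℕ∞) := by
  obtain ⟨-, -, -, -, -, hdvd, -⟩ := id hlex
  exact adicOrder_transform_lt_of_isLexMax hdim hlex (by rw [Nat.mul_div_cancel' hdvd]) hν hord

end LexMaxOrderDrop

end Summit.ResolutionOfSingularities.ResolutionOfSingularities.Theorems

end
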